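import Summits.ABC.IUTFork.Joshi.DictionaryUntiltsVolume
import Summits.ABC.IUTFork.Joshi.UntiltRescaled
import Summits.ABC.IUTFork.Joshi.TestIsmScalingResults
import HarnessLib

/-!
# Branch-E TEST (abc-iut-E-cx-3, THIRD block-E adversary): the LINEAR exponent read-out of the [J-I] cluster is structurally
# unrealisable — at the cell's `S`-model too

Block E of the abc-iut cell (rung LADDER-ABC:A2.E), written by the countermodel/test engine abc-iut-E-cx-3. PROOF-ONLY over landed
files imported BY NAME (R14 Test* file; DEFS-FREEZE respected: 0 `def`, 0 new `Prop`, no instance, no axiom, 0 `sorry`). **No side is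
taken** on [IUTchIII] Cor. 3.12, on Joshi's claims ([J-I] = K. Joshi, *Construction of Arithmetic Teichmüller spaces I*,
arXiv:2106.11452v4, bib `Joshi2021ATS1`; unrefereed) or on any report about them; typed ≠ proved ≠ endorsed.

S := `Summit.ABC.IUTFork.Cor312Vol.PilotKummerIndRelated S P ρ qK` (Cor312PinnedRegionsThreePins.lean l.145).

## What is tested
abc-iut-E-t1's LOCATION of the [J-I] cluster (DictionaryUntiltsVolume, p431910) reads Joshi's dilatation action
(`UntiltPoints.ActionDilates`, [J-I] v4 Thm 5.4.1 / Cor 5.4.2, WITNESSED by `threePoint_actionDilates`, p432361) against E-plan's Y₁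
components through the honesty condition `UntiltPoints.ExponentFaithful` («`logvol (ρ (datum y)) = κ · exponent y`, `κ ≠ 0`», a LINEAR
read-out of the scaling exponent by log-volumes) and concludes `¬(MovesAreInd ∧ DatumEquivariant)` from `LogvolInvariant` + (hρ) + (hAdm).
This file tests WHICH hypothesis is load-bearing, with the following kernel results (logic + names only):

* §1–§2 (model-free) `UntiltPoints.exponent_shift_eq_zero`: Joshi's exponent is POSITIVE (`exponent_pos`, p431060) and the acting
  object is a GROUP (`ptAct_mul`, `ptAct_one`); hence NO move `σ` can shift the exponent by a non-zero constant along all points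
  (iterate `σ` or `σ⁻¹` and leave the positive reals — Archimedes). Consequently (`not_exponentFaithful_of_logvol_shift`): if ONE
  dilating move `σ` translates the read log-volumes `logvol (ρ (datum ·))` by a constant (at each `(j, vQ)`), the linear read-out
  `ExponentFaithful` is FALSE — whatever the indeterminacies are.
* §3 (model-free) `not_datumEquivariant_and_exponentFaithful_of_translating`: `DatumEquivariant` + (hρ) for the realised move + «the
  realised move translates the log-volume of every read region by a constant» ⟹ `¬ ExponentFaithful` on every dilating signature.
  NEITHER `MovesAreInd` NOR `LogvolInvariant` is used: p431910's conclusion survives with both hypotheses deleted, i.e. the obstruction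
  is NOT the volume-invariance of (Ind1)/(Ind2) but «exponents MULTIPLY under dilatations / are positive, log-volumes SHIFT additively».
* §4 AT THE CELL'S `S`-MODEL (abc-iut-E-t41's X-07′ instantiation `IsmScaling.scalFull p` / `scalSetting p` / `scalRegion p`,
  TestIsmScalingShells p431238 / TestIsmScaling p431588 / TestIsmScalingResults p431886: `Ism = all ℚ-linear automorphisms`, (Ind2) ∋ `x ↦ p·x`, `¬ LogvolInvariant`, and **S HOLDS**
  (`scalSetting_pilotKummerIndRelated`)): EVERY packet automorphism is a scalar on each packet line (`exists_scalar`) and carries balls to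
  balls with a constant volume shift (`image_pBall_of_scalar`, `pVol_pBall`), and `scalRegion` is equivariant for ALL of them
  (`scalRegion_equivariant`); so `scal_not_datumEquivariant_and_exponentFaithful`: for EVERY points-signature with `ActionDilates`, EVERY
  `(datum, real)` with admissible readings, `¬(DatumEquivariant ∧ ExponentFaithful)` — at a model where S is TRUE and the indeterminacies
  are volume-NON-invariant. Non-vacuously on E-t1's `threePoint p 2` (`threePoint_scal_not_datumEquivariant_and_exponentFaithful`).

READING for the test ledger (neutral, R9/R13): together with TestUntiltsPinned §6 (the same conjunction fails at the `¬S` model of record)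
the conjunction «`DatumEquivariant ∧ ExponentFaithful` on a dilating signature» is FALSE AT BOTH MODELS OF RECORD (S false / S true): it
is not an S-test but a structurally unsatisfiable residual — R13 note «Y-UNSAT (linear read-out)» on the row's residual `ExponentFaithful`;
the [J-I] row's live residual must be RE-TYPED before it can co-vary with S (suggestion handed to the owner abc-iut-E-t1, not typed
here: a LOGARITHMIC read-out `logvol (ρ (datum y)) = κ · log (exponent y) + c`, under which a uniform dilatation `exponent (σ·y) =
λ · exponent y` IS an additive shift `κ · log λ` — realisable by a `p`-power scaling exactly where (Ind2) is volume-NON-invariant, and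
then p431910's `LogvolInvariant` becomes the load-bearing hypothesis it was meant to be). Located, not adjudicated.
[claim: Joshi2021ATS1, status: disputed]; our side [claim: Mochizuki2012, status: disputed]. Standard axioms only. bears_on: LADDER-ABC:A2.E.
-/

noncomputable section

open Set

/-! ## 1. A positive real-valued function admits no non-zero constant shift along a bijection (Archimedes) -/

namespace Summit.ABC.IUTFork.Joshi.Readout

/-- Iterating a map that shifts `e` by `d` shifts `e` by `n·d`. [folklore] -/
theorem apply_iterate_eq {X : Type} (e : X → ℝ) (f : X → X) (d : ℝ) (hf : ∀ x, e (f x) = e x + d) (n : ℕ) (x : X) :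
    e (f^[n] x) = e x + n * d := by
  induction n generalizing x with
  | zero => simp
  | succ n ih => rw [Function.iterate_succ_apply, ih, hf]; push_cast; ring

/-- **No constant shift of a positive function along a map with a right inverse, unless the shift is zero.** If `e > 0` everywhere,
`e (f x) = e x + d` for all `x`, and `f (g x) = x` for all `x`, then `d = 0` (for `d < 0` iterate `f`, for `d > 0` iterate `g`, and leave
the positive reals). Needs one point `x₀`. [folklore] -/
theorem shift_eq_zero_of_pos {X : Type} (e : X → ℝ) (f g : X → X) (hfg : ∀ x, f (g x) = x) (d : ℝ)
    (hf : ∀ x, e (f x) = e x + d) (hpos : ∀ x, 0 < e x) (x₀ : X) : d = 0 := by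
  by_contra hd
  have hg : ∀ x, e (g x) = e x + -d := fun x => by have h := hf (g x); rw [hfg] at h; linarith
  rcases lt_or_gt_of_ne hd with hneg | hpos'
  · -- d < 0: iterate f
    obtain ⟨n, hn⟩ := exists_nat_gt (e x₀ / -d)
    have h1 := apply_iterate_eq e f d hf n x₀
    have h2 := hpos (f^[n] x₀)
    rw [h1] at h2
    have h3 : e x₀ < n * -d := by rwa [div_lt_iff₀ (by linarith)] at hn
    linarith
  · -- d > 0: iterate g
    obtain ⟨n, hn⟩ := exists_nat_gt (e x₀ / d)
    have h1 := apply_iterate_eq e g (-d) hg n x₀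
    have h2 := hpos (g^[n] x₀)
    rw [h1] at h2
    have h3 : e x₀ < n * d := by rwa [div_lt_iff₀ hpos'] at hn
    linarith

end Summit.ABC.IUTFork.Joshi.Readout

/-! ## 2. Model-free: no move shifts Joshi's exponent by a non-zero constant; a volume-translating dilating move kills the linear read-out -/

namespace Summit.ABC.IUTFork.Joshi.UntiltPoints

open Summit.ABC.IUTFork.Thm311 Summit.ABC.IUTFork.Cor312 Summit.ABC.IUTFork.Joshi.Readout

variable {p : ℕ} [Fact p.Prime] {𝒪E : Type} [CommRing 𝒪E] (D : UntiltPoints p 𝒪E)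

/-- `σ⁻¹` undoes `σ` on points (the action is a group action: `ptAct_mul`, `ptAct_one`). [folklore] -/
theorem ptAct_inv_apply (σ : D.Aut) (y : D.Pt) : D.ptAct σ (D.ptAct σ⁻¹ y) = y := by
  rw [← D.ptAct_mul, mul_inv_cancel, D.ptAct_one]

/-- **No move shifts the scaling exponent by a non-zero constant**: `exponent (σ·y) = exponent y + d` for all `y` forces `d = 0`
(`exponent_pos` + Archimedes along the `σ`- or `σ⁻¹`-iterates). [folklore] -/
theorem exponent_shift_eq_zero (σ : D.Aut) (d : ℝ) (h : ∀ y, D.exponent (D.ptAct σ y) = D.exponent y + d) (y₀ : D.Pt) : d = 0 :=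
  shift_eq_zero_of_pos D.exponent (D.ptAct σ) (D.ptAct σ⁻¹) (D.ptAct_inv_apply σ) d h D.exponent_pos y₀

variable {T : ThetaIndex} (S : LatticeSituation T) (n : ℤ)
  (ρ : (∀ v : T.V, v ∈ T.Vbad → Set (S.L.StarPacket v)) → ∀ (j : T.Label) (vQ : T.VQ), Set (S.L.Packet j vQ))
  (datum : D.Pt → ∀ v : T.V, v ∈ T.Vbad → Set (S.L.StarPacket v))

/-- **A volume-translating DILATING move kills the linear read-out.** If some move `σ` changes the exponent of some point
(`ActionDilates`, orbit form) and translates the read log-volumes `logvol (ρ (datum ·)) ` by a constant at each `(j, vQ)`, then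
`ExponentFaithful` is FALSE — whatever the indeterminacies, admissibility or volume-invariance are. [claim: Joshi2021ATS1, status: disputed] -/
theorem not_exponentFaithful_of_logvol_shift (σ : D.Aut) (y₀ : D.Pt) (hne : D.exponent (D.ptAct σ y₀) ≠ D.exponent y₀)
    (hshift : ∀ (j : T.Label) (vQ : T.VQ), ∃ c : ℝ, ∀ y : D.Pt,
      (S.D n).logvol j vQ (ρ (datum (D.ptAct σ y)) j vQ) = (S.D n).logvol j vQ (ρ (datum y) j vQ) + c) :
    ¬ ExponentFaithful D S n ρ datum := by
  rintro ⟨j, vQ, κ, hκ, hf⟩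
  obtain ⟨c, hc⟩ := hshift j vQ
  have hd : ∀ y, D.exponent (D.ptAct σ y) = D.exponent y + c / κ := fun y => by
    have h := hc y
    rw [hf, hf] at h
    field_simp
    linarith
  have h0 : c / κ = 0 := D.exponent_shift_eq_zero σ (c / κ) hd y₀
  exact hne (by rw [hd y₀, h0, add_zero])

/-! ## 3. Model-free: `DatumEquivariant` + (hρ) + volume-translating realisation ⟹ ¬ExponentFaithful (no MovesAreInd, no LogvolInvariant) -/

/-- From `DatumEquivariant`, the equivariance (hρ) of `ρ` for the realised move `real σ`, and «`real σ` translates the log-volume of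
every read region by a constant», the read log-volumes are translated by a constant along `σ`. [folklore] -/
theorem logvol_shift_of_datumEquivariant {base std : D.Pt} (real : D.Aut → S.L.PacketAut) (σ : D.Aut)
    (hρσ : ∀ (Ψ : ∀ v : T.V, v ∈ T.Vbad → Set (S.L.StarPacket v)) (j : T.Label) (vQ : T.VQ),
      ρ (fun v hv => S.L.starAut (real σ) v '' Ψ v hv) j vQ = real σ j vQ '' ρ Ψ j vQ)
    (htr : ∀ (j : T.Label) (vQ : T.VQ), ∃ c : ℝ, ∀ y : D.Pt,
      (S.D n).logvol j vQ (real σ j vQ '' ρ (datum y) j vQ) = (S.D n).logvol j vQ (ρ (datum y) j vQ) + c)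
    (hE : DatumEquivariant (D.toDictionary S base std datum real)) (j : T.Label) (vQ : T.VQ) :
    ∃ c : ℝ, ∀ y : D.Pt,
      (S.D n).logvol j vQ (ρ (datum (D.ptAct σ y)) j vQ) = (S.D n).logvol j vQ (ρ (datum y) j vQ) + c := by
  obtain ⟨c, hc⟩ := htr j vQ
  refine ⟨c, fun y => ?_⟩
  have hy : datum (D.ptAct σ y) = fun v hv => S.L.starAut (real σ) v '' datum y v hv := funext fun v => funext fun hv => hE σ y v hv
  rw [hy, hρσ, hc]

/-- **THE SHARPENED LOCATION (model-free).** On a points-signature on which Joshi's action DILATES, a reading `(datum, real)` such that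
`ρ` is equivariant for the realised moves (hρ) and every realised move translates the log-volumes of the read regions by a constant,
CANNOT be both `DatumEquivariant` and `ExponentFaithful`. p431910's `not_movesAreInd_and_datumEquivariant` is the special case
«translation constant `0`» (volume-invariant (Ind1)/(Ind2) + `MovesAreInd`); here NEITHER `MovesAreInd` NOR `LogvolInvariant` occurs.
R13: the residual `ExponentFaithful` (linear read-out) is jointly unsatisfiable with `DatumEquivariant` in every volume-translating
situation. [claim: Joshi2021ATS1, status: disputed] -/
theorem not_datumEquivariant_and_exponentFaithful_of_translating {base std : D.Pt} (real : D.Aut → S.L.PacketAut)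
    (hDil : D.ActionDilates)
    (hρ' : ∀ (σ : D.Aut) (Ψ : ∀ v : T.V, v ∈ T.Vbad → Set (S.L.StarPacket v)) (j : T.Label) (vQ : T.VQ),
      ρ (fun v hv => S.L.starAut (real σ) v '' Ψ v hv) j vQ = real σ j vQ '' ρ Ψ j vQ)
    (htr : ∀ (σ : D.Aut) (j : T.Label) (vQ : T.VQ), ∃ c : ℝ, ∀ y : D.Pt,
      (S.D n).logvol j vQ (real σ j vQ '' ρ (datum y) j vQ) = (S.D n).logvol j vQ (ρ (datum y) j vQ) + c) :
    ¬ (DatumEquivariant (D.toDictionary S base std datum real) ∧ ExponentFaithful D S n ρ datum) := by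
  rintro ⟨hE, hX⟩
  obtain ⟨σ, y₀, hne⟩ := D.actionDilates_iff_exponent_ne.1 hDil
  exact D.not_exponentFaithful_of_logvol_shift S n ρ datum σ y₀ hne
    (D.logvol_shift_of_datumEquivariant S n ρ datum real σ (hρ' σ) (htr σ) hE) hX

end Summit.ABC.IUTFork.Joshi.UntiltPoints

/-! ## 4. At the cell's `S`-model (E-t41's X-07′ instantiation, volume-NON-invariant indeterminacies): the same conjunction fails -/

namespace Summit.ABC.IUTFork.Joshi

open Summit.ABC.IUTFork.Thm311 Summit.ABC.IUTFork.Cor312 Summit.ABC.IUTFork.Cor312Vol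
open Cor312.Checks Cor312.IdentifiedNonVacuity NaiveWitness IsmScaling

section Scal

variable {p : ℕ} [Fact p.Prime] {𝒪E : Type} [CommRing 𝒪E] (D : UntiltPoints p 𝒪E) (q : ℕ) [hq : Fact q.Prime]
  {base std : D.Pt} (datum : D.Pt → ∀ v : toyIndex.V, v ∈ toyIndex.Vbad → Set (signShells.StarPacket v))
  (real : D.Aut → signShells.PacketAut)

/-- At the X-07′ model EVERY packet automorphism translates the log-volume of every ADMISSIBLE `scalRegion`-reading by a constant:
at the label `0` the reading is `univ ↦ univ` (shift `0`); at a label `j ≠ 0` an admissible reading is a ball `B_k ↦ B_{k + v_q(ε)}`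
(`exists_scalar`, `image_pBall_of_scalar`, `pVol_pBall`), shift `−v_q(ε)·log q`. [folklore] -/
theorem scal_logvol_translate (Φ : signShells.PacketAut)
    (hadm : ∀ (y : D.Pt) (j : toyIndex.Label) (vQ : toyIndex.VQ),
      ((scalFull q).toLatticeSituation.D (scalSetting q).n).Adm j vQ (scalRegion q (datum y) j vQ))
    (j : toyIndex.Label) (vQ : toyIndex.VQ) : ∃ c : ℝ, ∀ y : D.Pt,
      ((scalFull q).toLatticeSituation.D (scalSetting q).n).logvol j vQ (Φ j vQ '' scalRegion q (datum y) j vQ) =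
        ((scalFull q).toLatticeSituation.D (scalSetting q).n).logvol j vQ (scalRegion q (datum y) j vQ) + c := by
  by_cases hj : j = 0
  · subst hj
    refine ⟨0, fun y => ?_⟩
    show pVol q 0 vQ (Φ 0 vQ '' scalRegion q (datum y) 0 vQ) = pVol q 0 vQ (scalRegion q (datum y) 0 vQ) + 0
    rw [scalRegion_zero, Set.image_univ_of_surjective (Φ 0 vQ).surjective, add_zero]
  · obtain ⟨ε, hε, hΦ⟩ := exists_scalar j vQ (Φ j vQ)
    refine ⟨-(padicValRat q ε : ℝ) * Real.log q, fun y => ?_⟩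
    rcases hadm y j vQ with ⟨h0, -⟩ | ⟨k, hk⟩
    · exact absurd h0 hj
    · show pVol q j vQ (Φ j vQ '' scalRegion q (datum y) j vQ) = pVol q j vQ (scalRegion q (datum y) j vQ) + _
      rw [hk, image_pBall_of_scalar q hε hΦ k, pVol_pBall, pVol_pBall]
      push_cast
      ring

/-- **At the cell's `S`-model the linear exponent read-out is unrealisable too.** At abc-iut-E-t41's X-07′ instantiation (`Ism` =
all ℚ-linear automorphisms, (Ind2) volume-NON-invariant, S TRUE: `scalSetting_pilotKummerIndRelated`), for EVERY points-signature with
`ActionDilates` and EVERY reading `(datum, real)` with admissible `scalRegion`-regions: `¬(DatumEquivariant ∧ ExponentFaithful)` —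
`scalRegion` is equivariant for ALL packet automorphisms (`scalRegion_equivariant`) and all of them translate volumes
(`scal_logvol_translate`). With TestUntiltsPinned §6 the conjunction is FALSE at BOTH models of record (S false / S true): Y-UNSAT datum
for the test ledger (R13), not an S-verdict. [claim: Joshi2021ATS1, status: disputed] -/
theorem scal_not_datumEquivariant_and_exponentFaithful (hDil : D.ActionDilates)
    (hadm : ∀ (y : D.Pt) (j : toyIndex.Label) (vQ : toyIndex.VQ),
      ((scalFull q).toLatticeSituation.D (scalSetting q).n).Adm j vQ (scalRegion q (datum y) j vQ)) :
    ¬ (DatumEquivariant (D.toDictionary (scalFull q).toLatticeSituation base std datum real) ∧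
        UntiltPoints.ExponentFaithful D (scalFull q).toLatticeSituation (scalSetting q).n (scalRegion q) datum) :=
  D.not_datumEquivariant_and_exponentFaithful_of_translating (scalFull q).toLatticeSituation (scalSetting q).n (scalRegion q)
    datum real hDil (fun σ Ψ j vQ => scalRegion_equivariant q (real σ) Ψ j vQ)
    fun σ j vQ => scal_logvol_translate D q datum (real σ) hadm j vQ

/-- … while S HOLDS there (E-t41, BY NAME) — the contrast that makes the previous theorem a Y-UNSAT datum rather than an S-test.
[claim: Mochizuki2012, status: disputed] -/
theorem scal_pilotKummerIndRelated_and_not_faithful (hDil : D.ActionDilates)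
    (hadm : ∀ (y : D.Pt) (j : toyIndex.Label) (vQ : toyIndex.VQ),
      ((scalFull q).toLatticeSituation.D (scalSetting q).n).Adm j vQ (scalRegion q (datum y) j vQ)) :
    PilotKummerIndRelated (scalFull q).toLatticeSituation (scalSetting q) (scalRegion q) (PinnedWitness.qDatum q) ∧
      ¬ (DatumEquivariant (D.toDictionary (scalFull q).toLatticeSituation base std datum real) ∧
          UntiltPoints.ExponentFaithful D (scalFull q).toLatticeSituation (scalSetting q).n (scalRegion q) datum) :=
  ⟨scalSetting_pilotKummerIndRelated q, scal_not_datumEquivariant_and_exponentFaithful D q datum real hDil hadm⟩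

end Scal

section ThreePointScal

variable (p : ℕ) [Fact p.Prime] (q : ℕ) [hq : Fact q.Prime]

/-- NON-VACUOUSLY (E-t1's `threePoint p 2`, `threePoint_actionDilates` BY NAME): at the `S`-model no admissible reading of the
three-point signature is both `DatumEquivariant` and `ExponentFaithful`. [claim: Joshi2021ATS1, status: disputed] -/
theorem threePoint_scal_not_datumEquivariant_and_exponentFaithful {base std : (threePoint p 2 two_pos).Pt}
    (datum : (threePoint p 2 two_pos).Pt → ∀ v : toyIndex.V, v ∈ toyIndex.Vbad → Set (signShells.StarPacket v))
    (real : (threePoint p 2 two_pos).Aut → signShells.PacketAut)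
    (hadm : ∀ (y : (threePoint p 2 two_pos).Pt) (j : toyIndex.Label) (vQ : toyIndex.VQ),
      ((scalFull q).toLatticeSituation.D (scalSetting q).n).Adm j vQ (scalRegion q (datum y) j vQ)) :
    ¬ (DatumEquivariant ((threePoint p 2 two_pos).toDictionary (scalFull q).toLatticeSituation base std datum real) ∧
        UntiltPoints.ExponentFaithful (threePoint p 2 two_pos) (scalFull q).toLatticeSituation (scalSetting q).n
          (scalRegion q) datum) :=
  scal_not_datumEquivariant_and_exponentFaithful _ q datum real (threePoint_actionDilates p 2 two_pos (by norm_num)) hadm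

end ThreePointScal

end Summit.ABC.IUTFork.Joshi

end
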